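import Literature.NumberTheory.Automorphic.UnitaryThreeAnisotropicFixedPointCriterion      -- ★ B-p14 (ii-a): `fixedPoint_mem_unitaryInt_iff`
import Literature.NumberTheory.Automorphic.UnitaryThreeAnisotropicFixedPointRegimes        -- ★ B-p14 (ii-b): `fixedPoint_cond01_iff`, `fixedPoint_expr00_eq_det_mul`, `fixedPoint_cond00_iff_of_two_mul_le`
import Literature.NumberTheory.Automorphic.UnitaryThreeAnisotropicStabilizerCosetInvariant -- ★ FILE 2d (this seat): `exists_coords_of_mem_stabilizer`
import Literature.NumberTheory.Automorphic.UnitOrbitalIntegralUnfoldingAnisotropic         -- ★ (F2′): `smul_mk_eq_iff_flickerDiag`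
import HarnessLib

/-!
# Prop. 16, the VANISHING rows: `m > N` (condition 1 reads `m ≤ N`) and `[N∕2] < m` with `|A_t − 1| = |ϖ|^M`, `M ≤ N` (condition 2 fails for every coset)
# (Flicker 1998, Prop. 16 p. 96 — LAYER B′ step 2, FILE 3 (iii-b), part 1)

Topic `NumberTheory/Automorphic`; namespace `Literature.NumberTheory.Automorphic.UnitaryGroup`.  THEOREMS ONLY (no `def`, no instance, no notation, no named fact, no
`sorry`; count-neutral).  Cell `pub/hodgecm-mathlib`, F0∕P3a road «D-N7-inert», line «N7nsCount» ((F11-c) `stub_irredGValueNeg`); LAYER B′ design pen + cutting hand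
A-p13 (g30) (DESIGN v3 `F0/P3a/A-p13/g30/DESIGN-LayerBprime-v3.A-p13g30.md`).  HONEST LABEL: HC_CM is proved only modulo the printed citations until rung 0 closes;
with ★ FILE 3 (iii-a) (rows `m ≤ [N∕2]`) this leaves exactly the row `[N∕2] < m ≤ N ∧ N < M` of Prop. 16's table (`(q+1)q^{N+2m}`) open (FILE 3 (iii-b), part 2).

THE MATHEMATICS.  `t ∈ S` of exponent `N` (`|q_t| = |r_t| = |ϖ|^N`, `|A_t − s_t| ≤ |ϖ|^{N+1}`).  For every coset `hH′_m`: `t·hH′_m = hH′_m ⟹ cond₁ ⟺ m ≤ N` (★ (F2′)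
`smul_mk_eq_iff_flickerDiag`, ★ B-p14 (ii-a) `fixedPoint_mem_unitaryInt_iff`, ★ (ii-b) `fixedPoint_cond01_iff` — the first expression has valuation EXACTLY `|ϖ|^N`).  So for
`N < m` the fixed-point set is empty: the support of the sum over `m` in ★ `natCard_fixedPoints_unitaryInt_eq_finsum_flickerDiag` is `{0, …, N}`.  ROW 2 WITH `M ≤ N`
(`|A_t − 1| = |ϖ|^M`): condition 2 is `|D_h·bracket| ≤ |ϖ^{2m+1}|` (★ `fixedPoint_expr00_eq_det_mul`, `|D_h| = 1`) and `|bracket| = |ϖ|^M` because the two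
correction terms are `≤ |ϖ|^{N+1} < |ϖ|^M` (`v_fixedPoint_bracket_eq_of_le`); `M ≤ N < 2m+1` makes it fail for every `h` — count `0` (table `iSixteenM`: row 2 needs `N < M`).

## References
* [Flicker1998UnitaryFL] Y. Z. Flicker, *Elementary proof of the fundamental lemma for a unitary group*, Canad. J. Math. 50 (1998), Prop. 16 p. 96.
-/

set_option autoImplicit false

noncomputable section

open scoped MatrixGroups WithZero Valued
open Matrix

namespace Literature.NumberTheory.Automorphic

namespace UnitaryGroup

open Literature.NumberTheory.Automorphic.HermitianLattice

variable {K : Type*} [Field K] [Valued K ℤᵐ⁰] {ϖ : K}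
  (σ : K →+* K) {J : Matrix (Fin 3) (Fin 3) K} (hJ : J = (StdForm.antidiagonal 3).over K)

set_option synthInstance.maxHeartbeats 200000 in
-- the `↥S`-action on `↥S ⧸ H′_m` is slow to synthesise (as in ★ (F2′))
include hJ in
/-- **A fixed coset forces `m ≤ N`**: `t·hH′_m = hH′_m → m ≤ N` (condition 1 of ★ (ii-a) is `m ≤ N` by ★ `fixedPoint_cond01_iff`). [cite: Flicker1998UnitaryFL, Prop. 16 p. 96] -/
theorem le_of_smul_mk_eq (hd : LocalConjDatum σ ϖ) (d : ℕ → ↥(unitaryGroupOfForm σ J)) (m : ℕ)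
    (hdm : ((d m : GL (Fin 3) K) : Matrix (Fin 3) (Fin 3) K) = !![ϖ ^ m, 0, 0; 0, 1, 0; 0, 0, (ϖ ^ m)⁻¹])
    {t : ↥(unitaryGroupOfForm σ J)} (ht : t ∈ MulAction.stabilizer (↥(unitaryGroupOfForm σ J)) (![1, 0, -(2 * ϖ)] : Fin 3 → K)) {bt qt rt st : K}
    (htc : ((t : GL (Fin 3) K) : Matrix (Fin 3) (Fin 3) K) = !![1 + 2 * ϖ * bt, qt, bt; 2 * ϖ * rt, st, rt; 4 * ϖ ^ 2 * bt, 2 * ϖ * qt, 1 + 2 * ϖ * bt])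
    (N : ℕ) (hqt : Valued.v qt = WithZero.exp (-(N : ℤ))) (hrt : Valued.v rt = WithZero.exp (-(N : ℤ)))
    (hAst : Valued.v ((1 + 4 * ϖ * bt) - st) ≤ WithZero.exp (-((N : ℤ) + 1)))
    (h : ↥(MulAction.stabilizer (↥(unitaryGroupOfForm σ J)) (![1, 0, -(2 * ϖ)] : Fin 3 → K)))
    (hfix : (⟨t, ht⟩ : ↥(MulAction.stabilizer (↥(unitaryGroupOfForm σ J)) (![1, 0, -(2 * ϖ)] : Fin 3 → K))) •
        (QuotientGroup.mk h : ↥(MulAction.stabilizer (↥(unitaryGroupOfForm σ J)) (![1, 0, -(2 * ϖ)] : Fin 3 → K)) ⧸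
          ((unitaryInt σ J).map (MulAut.conj (d m)).toMonoidHom).subgroupOf
            (MulAction.stabilizer (↥(unitaryGroupOfForm σ J)) (![1, 0, -(2 * ϖ)] : Fin 3 → K))) = QuotientGroup.mk h) :
    m ≤ N := by
  obtain ⟨b, q, r, s, hh⟩ := exists_coords_of_mem_stabilizer σ hJ hd h
  obtain ⟨hs, hq, -, -⟩ := stabilizer_valuation_bounds σ hJ hd hh
  rw [smul_mk_eq_iff_flickerDiag σ d m ⟨t, ht⟩ h, Subgroup.coe_mk, fixedPoint_mem_unitaryInt_iff σ hJ hd m hdm htc hh,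
    fixedPoint_cond01_iff σ hd hs hq N m hqt hrt hAst] at hfix
  exact hfix.1

set_option synthInstance.maxHeartbeats 200000 in
-- as above
include hJ in
/-- **PROP. 16, ROWS `m > N`: `#Fix_t(S ⧸ H′_m) = 0`** — the summand of ★ (F2′) `natCard_fixedPoints_unitaryInt_eq_finsum_flickerDiag` vanishes for `N < m`.
[cite: Flicker1998UnitaryFL, Prop. 16 p. 96] -/
theorem natCard_fixedPoints_quotient_of_lt (hd : LocalConjDatum σ ϖ) (d : ℕ → ↥(unitaryGroupOfForm σ J)) (m : ℕ)
    (hdm : ((d m : GL (Fin 3) K) : Matrix (Fin 3) (Fin 3) K) = !![ϖ ^ m, 0, 0; 0, 1, 0; 0, 0, (ϖ ^ m)⁻¹])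
    {t : ↥(unitaryGroupOfForm σ J)} (ht : t ∈ MulAction.stabilizer (↥(unitaryGroupOfForm σ J)) (![1, 0, -(2 * ϖ)] : Fin 3 → K)) {bt qt rt st : K}
    (htc : ((t : GL (Fin 3) K) : Matrix (Fin 3) (Fin 3) K) = !![1 + 2 * ϖ * bt, qt, bt; 2 * ϖ * rt, st, rt; 4 * ϖ ^ 2 * bt, 2 * ϖ * qt, 1 + 2 * ϖ * bt])
    (N : ℕ) (hNm : N < m) (hqt : Valued.v qt = WithZero.exp (-(N : ℤ))) (hrt : Valued.v rt = WithZero.exp (-(N : ℤ)))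
    (hAst : Valued.v ((1 + 4 * ϖ * bt) - st) ≤ WithZero.exp (-((N : ℤ) + 1))) :
    Nat.card {z : ↥(MulAction.stabilizer (↥(unitaryGroupOfForm σ J)) (![1, 0, -(2 * ϖ)] : Fin 3 → K)) ⧸
          ((unitaryInt σ J).map (MulAut.conj (d m)).toMonoidHom).subgroupOf
            (MulAction.stabilizer (↥(unitaryGroupOfForm σ J)) (![1, 0, -(2 * ϖ)] : Fin 3 → K)) |
        (⟨t, ht⟩ : ↥(MulAction.stabilizer (↥(unitaryGroupOfForm σ J)) (![1, 0, -(2 * ϖ)] : Fin 3 → K))) • z = z} = 0 := by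
  haveI : IsEmpty {z : ↥(MulAction.stabilizer (↥(unitaryGroupOfForm σ J)) (![1, 0, -(2 * ϖ)] : Fin 3 → K)) ⧸
      ((unitaryInt σ J).map (MulAut.conj (d m)).toMonoidHom).subgroupOf (MulAction.stabilizer (↥(unitaryGroupOfForm σ J)) (![1, 0, -(2 * ϖ)] : Fin 3 → K)) |
      (⟨t, ht⟩ : ↥(MulAction.stabilizer (↥(unitaryGroupOfForm σ J)) (![1, 0, -(2 * ϖ)] : Fin 3 → K))) • z = z} := by
    refine ⟨fun z => ?_⟩
    obtain ⟨z, hz⟩ := z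
    induction z using QuotientGroup.induction_on with | H h => ?_
    exact absurd (le_of_smul_mk_eq σ hJ hd d m hdm ht htc N hqt hrt hAst h hz) (by omega)
  exact Nat.card_of_isEmpty

/-! ## Row 2 with `M ≤ N`: the `A`-condition fails for every coset -/

/-- **Valuation of the bracket when `|A_t − 1| = |ϖ|^M`, `M ≤ N`**: the two correction terms are `≤ |ϖ|^{N+1} < |ϖ|^M`, so
`|(A_t − 1) − 4ϖ(A_t − s_t)N(q) − 4ϖ(X − Δ_tσX)| = |ϖ|^M` (ultrametric equality). [cite: Flicker1998UnitaryFL, Prop. 16 p. 96] -/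
theorem v_fixedPoint_bracket_eq_of_le (hd : LocalConjDatum σ ϖ) {At st qt s q : K} (hs : Valued.v s = 1) (hq : Valued.v q ≤ 1)
    (hAt : Valued.v At = 1) (hst1 : Valued.v st = 1) (N M : ℕ) (hMN : M ≤ N) (hAt1 : Valued.v (At - 1) = WithZero.exp (-(M : ℤ)))
    (hqt : Valued.v qt = WithZero.exp (-(N : ℤ))) (hAst : Valued.v (At - st) ≤ WithZero.exp (-((N : ℤ) + 1))) :
    Valued.v ((At - 1) - 4 * ϖ * (At - st) * (σ q * q) - 4 * ϖ * (qt * σ q * s - At / σ st * (σ qt * q * σ s))) = WithZero.exp (-(M : ℤ)) := by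
  have hvσ := hd.vσ
  have h4 : Valued.v (4 : K) = 1 := by rw [show (4 : K) = 2 * 2 by norm_num, map_mul, hd.v2, one_mul]
  have hσq : Valued.v (σ q) ≤ 1 := by rw [hvσ]; exact hq
  have hlt : WithZero.exp (-((N : ℤ) + 1)) < WithZero.exp (-(M : ℤ)) := by rw [WithZero.exp_lt_exp]; omega
  -- the two correction terms are `≤ |ϖ|^{N+1}`
  have h1 : Valued.v (4 * ϖ * (At - st) * (σ q * q)) < WithZero.exp (-(M : ℤ)) := by
    refine lt_of_le_of_lt ?_ hlt
    rw [map_mul, map_mul, map_mul, map_mul, h4, one_mul, hd.vϖ]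
    calc WithZero.exp (-1 : ℤ) * Valued.v (At - st) * (Valued.v (σ q) * Valued.v q)
        ≤ 1 * WithZero.exp (-((N : ℤ) + 1)) * (1 * 1) := by
          refine mul_le_mul' (mul_le_mul' ?_ hAst) (mul_le_mul' hσq hq)
          rw [← WithZero.exp_zero, WithZero.exp_le_exp]; norm_num
      _ = WithZero.exp (-((N : ℤ) + 1)) := by rw [one_mul, mul_one, mul_one]
  have h2 : Valued.v (4 * ϖ * (qt * σ q * s - At / σ st * (σ qt * q * σ s))) < WithZero.exp (-(M : ℤ)) := by
    refine lt_of_le_of_lt ?_ hlt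
    rw [map_mul, map_mul, h4, one_mul, hd.vϖ, show -((N : ℤ) + 1) = -1 + -(N : ℤ) by ring, WithZero.exp_add]
    refine mul_le_mul' le_rfl (Valuation.map_sub_le _ ?_ ?_)
    · rw [map_mul, map_mul, hqt, hs, mul_one]
      calc WithZero.exp (-(N : ℤ)) * Valued.v (σ q) ≤ WithZero.exp (-(N : ℤ)) * 1 := mul_le_mul' le_rfl hσq
        _ = _ := mul_one _
    · rw [map_mul, map_div₀, hAt, hvσ, hst1, div_one, one_mul, map_mul, map_mul, hvσ, hqt, hvσ, hs, mul_one]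
      calc WithZero.exp (-(N : ℤ)) * Valued.v q ≤ WithZero.exp (-(N : ℤ)) * 1 := mul_le_mul' le_rfl hq
        _ = _ := mul_one _
  have hT : Valued.v (-(4 * ϖ * (At - st) * (σ q * q) + 4 * ϖ * (qt * σ q * s - At / σ st * (σ qt * q * σ s)))) < Valued.v (At - 1) := by
    rw [Valuation.map_neg, hAt1]
    exact lt_of_le_of_lt (Valuation.map_add _ _ _) (max_lt h1 h2)
  rw [show (At - 1) - 4 * ϖ * (At - st) * (σ q * q) - 4 * ϖ * (qt * σ q * s - At / σ st * (σ qt * q * σ s)) =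
      (At - 1) + -(4 * ϖ * (At - st) * (σ q * q) + 4 * ϖ * (qt * σ q * s - At / σ st * (σ qt * q * σ s))) by ring,
    Valuation.map_add_eq_of_lt_left _ hT, hAt1]

set_option synthInstance.maxHeartbeats 200000 in
-- as above
include hJ in
/-- **Row 2 with `M ≤ N` (`[N∕2] < m`): no coset is fixed** — condition 2 of ★ (ii-a) reads `|D_h·bracket| ≤ |ϖ^{2m+1}|`, but `|bracket| = |ϖ|^M > |ϖ|^{2m+1}` (`M ≤ N < 2m+1`).
[cite: Flicker1998UnitaryFL, Prop. 16 p. 96] -/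
theorem not_smul_mk_eq_of_le (hd : LocalConjDatum σ ϖ) (d : ℕ → ↥(unitaryGroupOfForm σ J)) (m : ℕ)
    (hdm : ((d m : GL (Fin 3) K) : Matrix (Fin 3) (Fin 3) K) = !![ϖ ^ m, 0, 0; 0, 1, 0; 0, 0, (ϖ ^ m)⁻¹])
    {t : ↥(unitaryGroupOfForm σ J)} (ht : t ∈ MulAction.stabilizer (↥(unitaryGroupOfForm σ J)) (![1, 0, -(2 * ϖ)] : Fin 3 → K)) {bt qt rt st : K}
    (htc : ((t : GL (Fin 3) K) : Matrix (Fin 3) (Fin 3) K) = !![1 + 2 * ϖ * bt, qt, bt; 2 * ϖ * rt, st, rt; 4 * ϖ ^ 2 * bt, 2 * ϖ * qt, 1 + 2 * ϖ * bt])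
    (N M : ℕ) (hMN : M ≤ N) (hNm : N < 2 * m + 1) (hAt1 : Valued.v ((1 + 4 * ϖ * bt) - 1) = WithZero.exp (-(M : ℤ)))
    (hqt : Valued.v qt = WithZero.exp (-(N : ℤ))) (hAst : Valued.v ((1 + 4 * ϖ * bt) - st) ≤ WithZero.exp (-((N : ℤ) + 1)))
    (h : ↥(MulAction.stabilizer (↥(unitaryGroupOfForm σ J)) (![1, 0, -(2 * ϖ)] : Fin 3 → K))) :
    (⟨t, ht⟩ : ↥(MulAction.stabilizer (↥(unitaryGroupOfForm σ J)) (![1, 0, -(2 * ϖ)] : Fin 3 → K))) •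
        (QuotientGroup.mk h : ↥(MulAction.stabilizer (↥(unitaryGroupOfForm σ J)) (![1, 0, -(2 * ϖ)] : Fin 3 → K)) ⧸
          ((unitaryInt σ J).map (MulAut.conj (d m)).toMonoidHom).subgroupOf
            (MulAction.stabilizer (↥(unitaryGroupOfForm σ J)) (![1, 0, -(2 * ϖ)] : Fin 3 → K))) ≠ QuotientGroup.mk h := by
  obtain ⟨b, q, r, s, hh⟩ := exists_coords_of_mem_stabilizer σ hJ hd h
  obtain ⟨hst1, -, hAt, -⟩ := stabilizer_valuation_bounds σ hJ hd htc
  obtain ⟨hs, hq, hA, -⟩ := stabilizer_valuation_bounds σ hJ hd hh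
  obtain ⟨-, hU2, -⟩ := stabilizer_unitarity_relations σ hJ hd hh
  have hs0 : s ≠ 0 := fun h0 => by rw [h0, map_zero] at hs; exact zero_ne_one hs
  have hσs : σ s ≠ 0 := fun h0 => hs0 (by have e := congrArg σ h0; rwa [hd.σσ, map_zero] at e)
  have hst0 : st ≠ 0 := fun h0 => by rw [h0, map_zero] at hst1; exact zero_ne_one hst1
  have hσst : σ st ≠ 0 := fun h0 => hst0 (by have e := congrArg σ h0; rwa [hd.σσ, map_zero] at e)
  have hA0 : 1 + 4 * ϖ * b ≠ 0 := fun h0 => by rw [h0, map_zero] at hA; exact zero_ne_one hA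
  have hρ : 4 * ϖ * r = -(4 * ϖ * (1 + 4 * ϖ * b) * σ q) / σ s := by rw [stabilizer_r_eq σ hJ hd hh]; field_simp
  have hρt : 4 * ϖ * rt = -(4 * ϖ * (1 + 4 * ϖ * bt) * σ qt) / σ st := by rw [stabilizer_r_eq σ hJ hd htc]; field_simp
  have hΔ : (1 + 4 * ϖ * b) * s - 4 * ϖ * r * q = (1 + 4 * ϖ * b) / σ s := by
    have e := det_stabilizerModel_eq σ hJ hd hh
    rw [Matrix.det_fin_two_of] at e
    rw [← e]; ring
  have hvΔ : Valued.v ((1 + 4 * ϖ * b) * s - 4 * ϖ * r * q) = 1 := by rw [hΔ, map_div₀, hA, hd.vσ, hs, div_one]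
  have key := fixedPoint_expr00_eq_det_mul σ ϖ (At := 1 + 4 * ϖ * bt) (qt := qt) (st := st) hA0 hσs hσst hΔ hρ hρt hU2
  rw [Ne, smul_mk_eq_iff_flickerDiag σ d m ⟨t, ht⟩ h, Subgroup.coe_mk, fixedPoint_mem_unitaryInt_iff σ hJ hd m hdm htc hh]
  rintro ⟨-, h2⟩
  have e2 : s * ((1 + 4 * ϖ * bt) * (1 + 4 * ϖ * b) + qt * (4 * ϖ * r)) - q * (4 * ϖ * rt * (1 + 4 * ϖ * b) + st * (4 * ϖ * r)) -
      ((1 + 4 * ϖ * b) * s - 4 * ϖ * q * r) =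
      ((1 + 4 * ϖ * b) * s - 4 * ϖ * r * q) *
        ((1 + 4 * ϖ * bt - 1) - 4 * ϖ * (1 + 4 * ϖ * bt - st) * (σ q * q) -
          4 * ϖ * (qt * σ q * s - (1 + 4 * ϖ * bt) / σ st * (σ qt * q * σ s))) := by
    linear_combination key
  rw [e2, map_mul, hvΔ, one_mul, v_fixedPoint_bracket_eq_of_le σ hd hs hq hAt hst1 N M hMN hAt1 hqt hAst, hd.v_pow, WithZero.exp_le_exp] at h2
  omega

set_option synthInstance.maxHeartbeats 200000 in
-- as above
include hJ in
/-- **PROP. 16, ROW 2 with `M ≤ N`: `#Fix_t(S ⧸ H′_m) = 0` for `[N∕2] < m`** (`|A_t − 1| = |ϖ|^M`).  The summand of ★ (F2′), verbatim.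
[cite: Flicker1998UnitaryFL, Prop. 16 p. 96] -/
theorem natCard_fixedPoints_quotient_of_le_of_lt (hd : LocalConjDatum σ ϖ) (d : ℕ → ↥(unitaryGroupOfForm σ J)) (m : ℕ)
    (hdm : ((d m : GL (Fin 3) K) : Matrix (Fin 3) (Fin 3) K) = !![ϖ ^ m, 0, 0; 0, 1, 0; 0, 0, (ϖ ^ m)⁻¹])
    {t : ↥(unitaryGroupOfForm σ J)} (ht : t ∈ MulAction.stabilizer (↥(unitaryGroupOfForm σ J)) (![1, 0, -(2 * ϖ)] : Fin 3 → K)) {bt qt rt st : K}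
    (htc : ((t : GL (Fin 3) K) : Matrix (Fin 3) (Fin 3) K) = !![1 + 2 * ϖ * bt, qt, bt; 2 * ϖ * rt, st, rt; 4 * ϖ ^ 2 * bt, 2 * ϖ * qt, 1 + 2 * ϖ * bt])
    (N M : ℕ) (hMN : M ≤ N) (hNm : N < 2 * m + 1) (hAt1 : Valued.v ((1 + 4 * ϖ * bt) - 1) = WithZero.exp (-(M : ℤ)))
    (hqt : Valued.v qt = WithZero.exp (-(N : ℤ))) (hAst : Valued.v ((1 + 4 * ϖ * bt) - st) ≤ WithZero.exp (-((N : ℤ) + 1))) :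
    Nat.card {z : ↥(MulAction.stabilizer (↥(unitaryGroupOfForm σ J)) (![1, 0, -(2 * ϖ)] : Fin 3 → K)) ⧸
          ((unitaryInt σ J).map (MulAut.conj (d m)).toMonoidHom).subgroupOf
            (MulAction.stabilizer (↥(unitaryGroupOfForm σ J)) (![1, 0, -(2 * ϖ)] : Fin 3 → K)) |
        (⟨t, ht⟩ : ↥(MulAction.stabilizer (↥(unitaryGroupOfForm σ J)) (![1, 0, -(2 * ϖ)] : Fin 3 → K))) • z = z} = 0 := by
  haveI : IsEmpty {z : ↥(MulAction.stabilizer (↥(unitaryGroupOfForm σ J)) (![1, 0, -(2 * ϖ)] : Fin 3 → K)) ⧸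
      ((unitaryInt σ J).map (MulAut.conj (d m)).toMonoidHom).subgroupOf (MulAction.stabilizer (↥(unitaryGroupOfForm σ J)) (![1, 0, -(2 * ϖ)] : Fin 3 → K)) |
      (⟨t, ht⟩ : ↥(MulAction.stabilizer (↥(unitaryGroupOfForm σ J)) (![1, 0, -(2 * ϖ)] : Fin 3 → K))) • z = z} := by
    refine ⟨fun z => ?_⟩
    obtain ⟨z, hz⟩ := z
    induction z using QuotientGroup.induction_on with | H h => ?_
    exact not_smul_mk_eq_of_le σ hJ hd d m hdm ht htc N M hMN hNm hAt1 hqt hAst h hz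
  exact Nat.card_of_isEmpty

end UnitaryGroup

end Literature.NumberTheory.Automorphic

end
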